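import Mathlib
import Literature.NumberTheory.DiophantineGeometry.NoncriticalBelyiCore
import Literature.NumberTheory.DiophantineGeometry.NoncriticalBelyiMoebius
import Literature.NumberTheory.DiophantineGeometry.NoncriticalBelyiNormalize
import Literature.NumberTheory.DiophantineGeometry.BelyiPreimageCount

/-!
# Noncritical Belyi maps on `ℙ¹_ℚ`: a Belyi map over `ℚ` with prescribed cusps that is
# noncritical at `∞` ([NCBelyi] Thm. 2.5 in genus `0`; Scherr–Zieve Thm. 1 for `C = ℙ¹`)

S. Mochizuki, *Noncritical Belyi maps*, Math. J. Okayama Univ. **46** (2004)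
[cite: MochizukiNCBelyi2004], Theorem 2.5: "Let `X` be a smooth, proper, connected curve over `ℚ̄`
and `S, T ⊆ X(ℚ̄)` finite sets … such that `S ∩ T = ∅`.  Then there exists a morphism `φ : X → ℙ¹`
such that: (a) `φ` is unramified over `ℙ¹ ∖ {0, 1, ∞}`; (b) `φ(S) ⊆ {0, 1, ∞}`;
(c) `φ(T) ∩ {0, 1, ∞} = ∅`.  Moreover, if `X, S, T` are defined over a number field `F`, then `φ`
may be taken to be defined over `F`."  Z. Scherr, M. Zieve, *Separated Belyi maps*, MRL **21**
(2014) [cite: ScherrZieve2014], Thm. 1 (refinement: `φ` ramified at `S`).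

THIS FILE: the case `X = ℙ¹_ℚ`, `T = {∞}`, `S = A` an arbitrary finite set of algebraic numbers,
`φ` defined over `ℚ` — exactly the map "`β : ℙ¹ → ℙ¹` over `ℚ`, Belyi for `A`, NONCRITICAL AT
`∞`" used in the proof of [GenEll] Thm. 2.1 ((ii) ⇒ (i)) for `(ℙ¹, {0,1,∞})` (cf. the GenEllTwo
sub-DAG of the cell abc-iut, node G5; S6's GENELLTWO-P1ROUTE W6).  In the `(p, q) ∈ ℚ[x]²` format
of `BelyiLemma.lean` (`β = p/q`, `p, q` coprime; ramification at finite non-poles read through the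
Wronskian `p'q − pq'`), `NoncriticalBelyi.exists_belyi_noncritical_infty` gives:

* `deg p = deg q = deg (p − q) = n ≥ 1`, i.e. `β(∞) = lc p / lc q ∉ {0, 1, ∞}`;
* `p_{n−1} q_n ≠ p_n q_{n−1}`, i.e. `β − β(∞)` has a SIMPLE zero at `∞` (`β` unramified at `∞`);
* for every complex `z` with `q(z) ≠ 0` and `(p'q − pq')(z) = 0`: `β(z) ∈ {0, 1}` (with the poles
  mapping to `∞`, the branch locus of `β` is contained in `{0, 1, ∞}`: `β` is a Belyi map);
* every `a ∈ A` is a zero of `p·q·(p − q)`, i.e. `β(A) ⊆ {0, 1, ∞}`;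
and `exists_belyi_noncritical_infty_card` adds `#β⁻¹{0, 1, ∞} = n + 2` (`BelyiPreimageCount`).

Proof = `normalize` (Möbius `μ(x) = b₀x/(x + c)` sending `∞ ↦ b₀` with `|b₀|_p > 1` and `A` to
algebraic integers) + `core` (steps I + II: a Belyi pair `(P, Q)` protecting `b₀`) + the
homogenised substitution `H_n` of `NoncriticalBelyiMoebius.lean` (`p := H_n(P)`, `q := H_n(Q)`),
whose Wronskian chain rule is the only analytic input.  No definitions, no named facts; classical
and outside the IUT dispute (the theorem is granted by Scholze–Stix 2018 §1.2).
-/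

namespace Literature.NumberTheory.DiophantineGeometry

open Polynomial Finset

namespace NoncriticalBelyi

/-- **Noncritical Belyi map on `ℙ¹_ℚ` protecting `∞`** ([NCBelyi] Thm. 2.5 for `X = ℙ¹_ℚ`,
`T = {∞}`; Scherr–Zieve Thm. 1 for `C = ℙ¹`).  For every finite set `A ⊂ ℂ` of algebraic numbers
there are coprime `p, q ∈ ℚ[x]` of the same degree `n ≥ 1`, with `deg (p − q) = n` and
`p_{n−1} q_n ≠ p_n q_{n−1}` (so `β := p/q` satisfies `β(∞) ∉ {0, 1, ∞}` and is unramified at `∞`),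
such that at every complex non-pole zero of `p'q − pq'` the value of `β` is `0` or `1` (Belyi), and
`p·q·(p − q)` vanishes on `A` (`β(A) ⊆ {0, 1, ∞}`).
[cite: MochizukiNCBelyi2004, Thm 2.5] -/
theorem exists_belyi_noncritical_infty (A : Finset ℂ) (hA : ∀ a ∈ A, IsAlgebraic ℚ a) :
    ∃ (p q : ℚ[X]) (n : ℕ), 0 < n ∧ p.natDegree = n ∧ q.natDegree = n ∧ (p - q).natDegree = n ∧
      p.coeff (n - 1) * q.coeff n ≠ p.coeff n * q.coeff (n - 1) ∧ IsCoprime p q ∧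
      (∀ z : ℂ, aeval z q ≠ 0 → aeval z (derivative p * q - p * derivative q) = 0 →
        aeval z p = 0 ∨ aeval z p = aeval z q) ∧
      ∀ a ∈ A, aeval a (p * q * (p - q)) = 0 := by
  classical
  -- the normalising Möbius map and the Belyi pair protecting `b₀`
  obtain ⟨pr, hpr, b₀, c, hb₀, hb₀0, hc0, hμ⟩ := normalize A hA
  set S : Finset ℂ := A.image fun a => algebraMap ℚ ℂ b₀ * a / (a + algebraMap ℚ ℂ c) with hS
  have hSint : ∀ s ∈ S, IsIntegral ℤ s := by
    intro s hs; obtain ⟨a, ha, rfl⟩ := mem_image.1 hs; exact (hμ a ha).2.1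
  have hSdeg : ∀ s ∈ S, (minpoly ℚ s).natDegree < pr := by
    intro s hs; obtain ⟨a, ha, rfl⟩ := mem_image.1 hs; exact (hμ a ha).2.2
  obtain ⟨P, Q, d, hd, hPd, hQd, hlead, hcop, hcrit, hSval, hPb, hQb, hPQb, hWb⟩ :=
    core pr S hSint hSdeg b₀ hb₀
  -- the homogenised substitutions
  set HP : ℚ[X] := ∑ j ∈ range (d + 1), C (P.coeff j * b₀ ^ j) * X ^ j * (X + C c) ^ (d - j)
    with hHP
  set HQ : ℚ[X] := ∑ j ∈ range (d + 1), C (Q.coeff j * b₀ ^ j) * X ^ j * (X + C c) ^ (d - j)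
    with hHQ
  have hPle : P.natDegree ≤ d := hPd.le
  have hQle : Q.natDegree ≤ d := hQd.le
  have hHPtop : HP.coeff d = P.eval b₀ := homSubst_coeff_top P d b₀ c hPle
  have hHQtop : HQ.coeff d = Q.eval b₀ := homSubst_coeff_top Q d b₀ c hQle
  have hHPdeg : HP.natDegree = d :=
    natDegree_eq_of_le_of_coeff_ne_zero (homSubst_natDegree_le P d b₀ c) (by rwa [hHPtop])
  have hHQdeg : HQ.natDegree = d :=
    natDegree_eq_of_le_of_coeff_ne_zero (homSubst_natDegree_le Q d b₀ c) (by rwa [hHQtop])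
  have hbc : b₀ * c ≠ 0 := mul_ne_zero hb₀0 hc0
  -- values at the pole `-c` of `μ`: `lc(P)·(−b₀c)^d = lc(Q)·(−b₀c)^d ≠ 0`
  have hPc : P.coeff d ≠ 0 := by
    have h1 : P.coeff d = P.leadingCoeff := by rw [leadingCoeff, hPd]
    rw [h1, ne_eq, leadingCoeff_eq_zero]
    rintro rfl; simp at hPb
  have hQc : Q.coeff d = P.coeff d := by
    have h1 := hlead; rw [leadingCoeff, leadingCoeff, hPd, hQd] at h1; exact h1.symm
  have hpole : aeval (-algebraMap ℚ ℂ c) HP = aeval (-algebraMap ℚ ℂ c) HQ ∧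
      aeval (-algebraMap ℚ ℂ c) HP ≠ 0 := by
    rw [hHP, hHQ, aeval_homSubst_neg, aeval_homSubst_neg, hQc]
    refine ⟨rfl, ?_⟩
    rw [map_ne_zero_iff _ (algebraMap ℚ ℂ).injective]
    exact mul_ne_zero hPc (pow_ne_zero _ (neg_ne_zero.2 hbc))
  refine ⟨HP, HQ, d, hd, hHPdeg, hHQdeg, ?_, ?_, ?_, ?_, ?_⟩
  · -- `deg (p - q) = n`: the top coefficients `P(b₀) ≠ Q(b₀)`
    refine natDegree_eq_of_le_of_coeff_ne_zero
      ((natDegree_sub_le _ _).trans (by rw [hHPdeg, hHQdeg, max_self])) ?_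
    rw [coeff_sub, hHPtop, hHQtop]; exact sub_ne_zero.2 hPQb
  · -- unramified at `∞`: `p_{n-1} q_n − p_n q_{n-1} = −c·b₀·W(P,Q)(b₀) ≠ 0`
    rw [hHPtop, hHQtop, homSubst_coeff_pred P d b₀ c hPle hd, homSubst_coeff_pred Q d b₀ c hQle hd]
    intro h
    apply mul_ne_zero (mul_ne_zero hc0 hb₀0) hWb
    rw [eval_sub, eval_mul, eval_mul]
    linear_combination -h
  · -- coprime: no common complex zero
    rw [Polynomial.isCoprime_iff_aeval_ne_zero_of_isAlgClosed ℚ ℂ]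
    intro z
    by_cases hz : z + algebraMap ℚ ℂ c = 0
    · have hz' : z = -algebraMap ℚ ℂ c := eq_neg_of_add_eq_zero_left hz
      rw [hz']; exact Or.inl hpole.2
    · rw [hHP, hHQ, aeval_homSubst P d b₀ c hPle z hz, aeval_homSubst Q d b₀ c hQle z hz]
      have hzd : (z + algebraMap ℚ ℂ c) ^ d ≠ 0 := pow_ne_zero _ hz
      rcases (Polynomial.isCoprime_iff_aeval_ne_zero_of_isAlgClosed ℚ ℂ P Q).1 hcop
        (algebraMap ℚ ℂ b₀ * z / (z + algebraMap ℚ ℂ c)) with h | h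
      · exact Or.inl (mul_ne_zero hzd h)
      · exact Or.inr (mul_ne_zero hzd h)
  · -- Belyi: finite critical points away from the poles map to `0` or `1`
    intro z hqz hWz
    by_cases hz : z + algebraMap ℚ ℂ c = 0
    · have hz' : z = -algebraMap ℚ ℂ c := eq_neg_of_add_eq_zero_left hz
      right; rw [hz']; exact hpole.1
    · have hWy := wronskian_homSubst_eq_zero d b₀ c P Q hPle hQle hbc z hz hqz hWz
      have hQy : aeval (algebraMap ℚ ℂ b₀ * z / (z + algebraMap ℚ ℂ c)) Q ≠ 0 := by
        intro h; apply hqz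
        rw [hHQ, aeval_homSubst Q d b₀ c hQle z hz, h, mul_zero]
      rcases hcrit _ hWy with h | h
      · left; rw [hHP, aeval_homSubst P d b₀ c hPle z hz, h, mul_zero]
      · exact absurd h hQy
  · -- `A ↦ {0, 1, ∞}`
    intro a ha
    obtain ⟨hac, -, -⟩ := hμ a ha
    have hs : algebraMap ℚ ℂ b₀ * a / (a + algebraMap ℚ ℂ c) ∈ S := mem_image.2 ⟨a, ha, rfl⟩
    rw [map_mul, map_mul, hHP, hHQ, aeval_homSubst P d b₀ c hPle a hac,
      aeval_homSubst Q d b₀ c hQle a hac]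
    rcases hSval _ hs with h | h
    · rw [h, mul_zero, zero_mul, zero_mul]
    · rw [h, mul_zero, mul_zero, zero_mul]

/-- **Main theorem with the Riemann–Hurwitz count**: the Belyi pair of
`exists_belyi_noncritical_infty` together with `#β⁻¹{0, 1, ∞} = deg β + 2` — the number of
distinct complex roots of `p·q·(p − q)` is `n + 2` (`BelyiPreimageCount.lean`).  This is the form
consumed by the (ii) ⇒ (i) bookkeeping of [GenEll] Thm. 2.1 on `ℙ¹` (conductor of the reduced
divisor `β⁻¹{0,1,∞}` against the height gain `deg β`). [cite: MochizukiNCBelyi2004, Thm 2.5] -/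
theorem exists_belyi_noncritical_infty_card (A : Finset ℂ) (hA : ∀ a ∈ A, IsAlgebraic ℚ a) :
    ∃ (p q : ℚ[X]) (n : ℕ), 0 < n ∧ p.natDegree = n ∧ q.natDegree = n ∧ (p - q).natDegree = n ∧
      p.coeff (n - 1) * q.coeff n ≠ p.coeff n * q.coeff (n - 1) ∧ IsCoprime p q ∧
      (∀ z : ℂ, aeval z q ≠ 0 → aeval z (derivative p * q - p * derivative q) = 0 →
        aeval z p = 0 ∨ aeval z p = aeval z q) ∧
      (∀ a ∈ A, aeval a (p * q * (p - q)) = 0) ∧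
      ((p * q * (p - q)).map (algebraMap ℚ ℂ)).roots.toFinset.card = n + 2 := by
  obtain ⟨p, q, n, hn, hp, hq, hpq, hunr, hcop, hcrit, hval⟩ := exists_belyi_noncritical_infty A hA
  exact ⟨p, q, n, hn, hp, hq, hpq, hunr, hcop, hcrit, hval,
    card_cusp_preimages p q n hn hp hq hpq hunr hcop hcrit⟩

/-- For `F ∈ ℚ[x] ∖ 0`: `deg (radical F)` is the number of distinct complex roots of `F` (the radical
is squarefree, hence separable in characteristic `0`, and has the same roots as `F`). [folklore] -/
private theorem natDegree_radical_eq_card_roots (F : ℚ[X]) (hF : F ≠ 0) :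
    (UniqueFactorizationMonoid.radical F).natDegree =
      ((F.map (algebraMap ℚ ℂ)).roots.toFinset).card := by
  classical
  set R : ℚ[X] := UniqueFactorizationMonoid.radical F with hR
  have hRF : R ∣ F := UniqueFactorizationMonoid.radical_dvd_self
  have hR0 : R ≠ 0 := fun h => hF (zero_dvd_iff.1 (h ▸ hRF))
  have hsep : R.Separable :=
    PerfectField.separable_iff_squarefree.2 UniqueFactorizationMonoid.squarefree_radical
  have hinj := (algebraMap ℚ ℂ).injective
  have hroots :
      (R.map (algebraMap ℚ ℂ)).roots.toFinset = (F.map (algebraMap ℚ ℂ)).roots.toFinset := by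
    ext x
    simp only [Multiset.mem_toFinset, mem_roots ((Polynomial.map_ne_zero_iff hinj).2 hR0),
      mem_roots ((Polynomial.map_ne_zero_iff hinj).2 hF), IsRoot.def, eval_map_algebraMap]
    constructor
    · intro hx
      obtain ⟨G, hG⟩ := hRF
      rw [hG, map_mul, hx, zero_mul]
    · intro hx
      obtain ⟨n, G, hG⟩ := UniqueFactorizationMonoid.exists_dvd_radical_self_pow hF (a := F)
      have h1 : aeval x R ^ n = 0 := by rw [← map_pow, hR, hG, map_mul, hx, zero_mul]
      exact (pow_eq_zero_iff'.1 h1).1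
  rw [← hroots, Multiset.toFinset_card_of_nodup (nodup_roots (hsep.map)),
    IsAlgClosed.card_roots_eq_natDegree, natDegree_map]

/-- **Polynomial-input form** (the shape requested by the GenEllTwo package owner, S6): the cusp set
is given as the root set of a nonzero `c ∈ ℚ[x]`, and "`β(A) ⊆ {0, 1, ∞}`" is returned FIELD-FREE —
every root `θ` of `c` in ANY field over `ℚ` (e.g. `ℂ`, `ℚ̄₂`, a number field) is a root of
`p·q·(p − q)` — together with `lc p ≠ lc q`, the unramified-at-`∞` coefficient condition, the Belyi
clause over `ℂ`, and the count `#β⁻¹{0,1,∞} = n + 2`, both as the number of distinct complex roots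
of `p·q·(p − q)` and field-free as `deg radical(p·q·(p − q)) = n + 2`.
[cite: MochizukiNCBelyi2004, Thm 2.5] -/
theorem exists_belyi_noncritical_infty_of_poly (c : ℚ[X]) (hc : c ≠ 0) :
    ∃ (p q : ℚ[X]) (n : ℕ), 0 < n ∧ p.natDegree = n ∧ q.natDegree = n ∧ (p - q).natDegree = n ∧
      p.leadingCoeff ≠ q.leadingCoeff ∧
      p.coeff (n - 1) * q.coeff n ≠ p.coeff n * q.coeff (n - 1) ∧ IsCoprime p q ∧
      (∀ z : ℂ, aeval z q ≠ 0 → aeval z (derivative p * q - p * derivative q) = 0 →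
        aeval z p = 0 ∨ aeval z p = aeval z q) ∧
      (∀ {K : Type} [Field K] [Algebra ℚ K] (θ : K), aeval θ c = 0 →
        aeval θ (p * q * (p - q)) = 0) ∧
      ((p * q * (p - q)).map (algebraMap ℚ ℂ)).roots.toFinset.card = n + 2 ∧
      (UniqueFactorizationMonoid.radical (p * q * (p - q))).natDegree = n + 2 := by
  classical
  set A : Finset ℂ := (c.map (algebraMap ℚ ℂ)).roots.toFinset with hA
  have hcC : c.map (algebraMap ℚ ℂ) ≠ 0 :=
    (Polynomial.map_ne_zero_iff (algebraMap ℚ ℂ).injective).2 hc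
  have hAalg : ∀ a ∈ A, IsAlgebraic ℚ a := by
    intro a ha
    rw [hA, Multiset.mem_toFinset, mem_roots hcC, IsRoot.def, eval_map_algebraMap] at ha
    exact ⟨c, hc, ha⟩
  obtain ⟨p, q, n, hn, hp, hq, hpq, hunr, hcop, hcrit, hval, hcard⟩ :=
    exists_belyi_noncritical_infty_card A hAalg
  have hF0 : p * q * (p - q) ≠ 0 := by
    intro h0
    have := congrArg natDegree h0
    rw [natDegree_mul (mul_ne_zero ?_ ?_) ?_, natDegree_mul, hp, hq, hpq, natDegree_zero] at this
    · omega
    all_goals rintro h1; all_goals simp [h1] at hp hq hpq; all_goals omega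
  refine ⟨p, q, n, hn, hp, hq, hpq, ?_, hunr, hcop, hcrit, ?_, hcard,
    by rw [natDegree_radical_eq_card_roots _ hF0, hcard]⟩
  · -- `lc p ≠ lc q` from `deg (p − q) = n`
    intro h
    have hpq0 : p - q ≠ 0 := by rintro h0; rw [h0, natDegree_zero] at hpq; omega
    have hlc : (p - q).leadingCoeff = 0 := by
      rw [leadingCoeff, hpq, coeff_sub, ← hp, coeff_natDegree, hp, ← hq, coeff_natDegree, h,
        sub_self]
    exact hpq0 (leadingCoeff_eq_zero.1 hlc)
  · -- field-free vanishing on the roots of `c`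
    intro K _ _ θ hθ
    have hθalg : IsAlgebraic ℚ θ := ⟨c, hc, hθ⟩
    have hθint : IsIntegral ℚ θ := hθalg.isIntegral
    set g : ℚ[X] := minpoly ℚ θ with hg
    have hgc : g ∣ c := minpoly.dvd ℚ θ hθ
    have hgdeg : g.degree ≠ 0 := (minpoly.degree_pos hθint).ne'
    obtain ⟨θ', hθ'⟩ := IsAlgClosed.exists_aeval_eq_zero ℂ g hgdeg
    have hθ'c : aeval θ' c = 0 := by
      obtain ⟨h, rfl⟩ := hgc; rw [map_mul, hθ', zero_mul]
    have hθ'A : θ' ∈ A := by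
      rw [hA, Multiset.mem_toFinset, mem_roots hcC, IsRoot.def, eval_map_algebraMap]; exact hθ'c
    have hF := hval θ' hθ'A
    have hg' : g = minpoly ℚ θ' :=
      minpoly.eq_of_irreducible_of_monic (minpoly.irreducible hθint) hθ' (minpoly.monic hθint)
    have hgF : g ∣ p * q * (p - q) := by rw [hg']; exact minpoly.dvd ℚ θ' hF
    obtain ⟨h, hh⟩ := hgF
    rw [hh, map_mul, hg, minpoly.aeval, zero_mul]

/-- The same statement in the clause format of `BelyiLemmaGenusZero` (`BelyiLemma.lean`), for direct
comparison: there `h(∞) ∈ {0, 1, ∞}` is REQUIRED (`∞` is a cusp), here the `∞`-clause is replaced by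
its negation together with unramifiedness at `∞`; the ramification clause at finite non-poles and
the `S`-clause (`S = A`) are identical.  Coefficient form of "unramified at `∞`":
`deg (q_n·p − p_n·q) = n − 1`. [cite: MochizukiNCBelyi2004, Thm 2.5] -/
theorem exists_belyi_noncritical_infty' (A : Finset ℂ) (hA : ∀ a ∈ A, IsAlgebraic ℚ a) :
    ∃ p q : ℚ[X], IsCoprime p q ∧ 0 < p.natDegree ∧ q.natDegree = p.natDegree ∧
      (p - q).natDegree = p.natDegree ∧
      (C (q.leadingCoeff) * p - C (p.leadingCoeff) * q).natDegree + 1 = p.natDegree ∧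
      (∀ z : ℂ, (q.map (algebraMap ℚ ℂ)).eval z ≠ 0 →
        ((derivative p * q - p * derivative q).map (algebraMap ℚ ℂ)).eval z = 0 →
          (p.map (algebraMap ℚ ℂ)).eval z = 0 ∨
            (p.map (algebraMap ℚ ℂ)).eval z = (q.map (algebraMap ℚ ℂ)).eval z) ∧
      ∀ s ∈ A, ((p * q * (p - q)).map (algebraMap ℚ ℂ)).eval s = 0 := by
  obtain ⟨p, q, n, hn, hp, hq, hpq, hunr, hcop, hcrit, hval⟩ := exists_belyi_noncritical_infty A hA
  refine ⟨p, q, hcop, by omega, by omega, by omega, ?_, ?_, ?_⟩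
  · -- `deg (q_n p − p_n q) = n − 1`
    rw [hp]
    have hle : (C q.leadingCoeff * p - C p.leadingCoeff * q).natDegree ≤ n - 1 := by
      rw [natDegree_le_iff_coeff_eq_zero]
      intro m hm
      rw [coeff_sub, coeff_C_mul, coeff_C_mul]
      rcases Nat.lt_or_ge n m with hnm | hnm
      · rw [coeff_eq_zero_of_natDegree_lt (by omega), coeff_eq_zero_of_natDegree_lt (by omega),
          mul_zero, mul_zero, sub_zero]
      · have hm' : m = n := by omega
        subst hm'
        rw [leadingCoeff, leadingCoeff, hp, hq]; ring
    have hcoeff : (C q.leadingCoeff * p - C p.leadingCoeff * q).coeff (n - 1) ≠ 0 := by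
      rw [coeff_sub, coeff_C_mul, coeff_C_mul, leadingCoeff, leadingCoeff, hp, hq]
      intro h; apply hunr; linear_combination h
    rw [natDegree_eq_of_le_of_coeff_ne_zero hle hcoeff]
    omega
  · intro z hq0 hW
    simp only [eval_map_algebraMap] at hq0 hW ⊢
    exact hcrit z hq0 hW
  · intro s hs
    rw [eval_map_algebraMap]; exact hval s hs

end NoncriticalBelyi

end Literature.NumberTheory.DiophantineGeometry
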